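/-
Origin: expansion seat `planner-pub-hodgecm-carver-0`, handover 2026-08-18T03:27:49Z (synced 03:34:05Z) (`HOME/pub-hodgecm-carver/lean/Carver/PerL34/Spans.lean`, md5 570ed427, 68 lines);
landed by the gen-5 packager in gate run 18 as `HodgeCM/PerL34/Spans.lean` (verbatim).
-/
/-
Origin: HOME/pub-hodgecm-carver/lean/HodgeCM/PerL34/Spans.lean — session planner-pub-hodgecm-carver-0 (unit
pub-hodgecm-carver, THE CARVER).  Intended final place: `HodgeCM/PerL34/Spans.lean`.
DAG nodes (HOME/LEMMAS.md §1): N17 (Lemma 3.4 seesaw), N18 (§3.3 set-up), N19 (Lemma 3.5, both inclusions),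
N20 (Lemma 3.5 last assertion).  Nothing is asserted; `_holds` theorems are projections of model DATA (they record
that the step is currently POSITED as a field of the frozen prior interface, FACTS.md A2).
-/
import Summits.HodgeConjecture.HodgeCM.Automorphic.ThetaFacts

set_option autoImplicit false

/-!
# PerL v5 §3.3 — the spans `S₁₂`, `S₃₄` (DAG nodes N17–N20)

* **N17** (Lemma 3.4 `lem:seesaw`, tex ll. 318–327): the seesaw identity (eq:seesaw).  NOT typeable today (no
  Weil-representation vocabulary, LEMMAS.md §3 D4); it is the print heart of N19's two directions below.
* **N18** (ll. 341–349): `𝒮`, `κ`, `𝒮^κ`, `ϑ_{T,χ₁₂}(Φ) ∈ C([G_U])` "a continuous function of `Φ`", and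
  `S_{12}:=\ol{\mathrm{span}}\{\vartheta_{T,\chi_{12}}(\Phi)\}`.  Typed: `N18_thetaCont` (= field `AX5b_ϑ_cont`,
  POSITED) and the definitional pin `S12_def` (a field; nothing to prove).
* **N19** (Lemma 3.5 `lem:S12`, ll. 350–353): "`S_{12}` is the closure of the span of the wedges `u_1\wedge u_2`
  … with `u_j` holomorphic `1`-forms attached to vectors of `\pi_j[\fp_+]`, `\pi_j=\Theta^{W_j}_{\mu_j}(\chi'_j)` the
  theta spaces of allowed pairs of type `(12)`; similarly for `S_{34}`."  Two inclusions, typed separately: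
  `N19w_wedgeMem` (every wedge is a generator; = `Open_thetaGen12`, pair (12)) and `N19g_genInWedgeSpan` (every
  generator lies in the CLOSED span of wedges; = `Open_thetaReal34`, pair (34), closure form of run 12 / E2).
* **N20** (l. 353, proof ll. 375–378): "Consequently, if `S_{12}\not\perp S_{34}` then `W^L_{\rm per}(K)` holds."
  PROVED over the interface: `HodgeCM.StubTree.thm44_of_realisation` (PerLProof.lean) — nothing to do here.
-/

noncomputable section

namespace HodgeCM
namespace PerL34

open HodgeCM.Prior.Perl34File

variable {U : Universe} (T : U.ThetaModel)

/-- **N18** (PerL v5 §3.3, tex ll. 343–347): "`\Phi\mapsto\theta_\Phi` is continuous from `\cS` to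
`C([G_U]\times[\U(W)])` (uniform norm) … `\vartheta_{T,\chi_{12}}(\Phi):=\int_{[T]}\theta_\Phi(\cdot,t)\chi_{12}(t)\,dt
\in C([G_U])`, a continuous function of `\Phi`".  Typed over the model's torus sides; currently POSITED as the
field `TorusData.AX5b_ϑ_cont` (FACTS.md A2). -/
def N18_thetaCont : Prop :=
  ∀ {L : CMField} {ι₁ : L →+* ℂ} (V : HermSpace3 L ι₁) (c : SeesawCtx L),
    (∀ χ, Continuous ((T.t12 V c).ϑc χ)) ∧ (∀ χ, Continuous ((T.t34 V c).ϑc χ))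

/-- N18 holds for every theta model BY PROJECTION of model data (the continuity is a field of the frozen
`TorusData`): this records that PerL's continuity claim is presently an ASSUMED property of the posited objects. -/
theorem N18_holds : N18_thetaCont T :=
  fun V c => ⟨fun χ => (T.t12 V c).AX5b_ϑ_cont χ, fun χ => (T.t34 V c).AX5b_ϑ_cont χ⟩

/-- **N19w** (PerL v5 Lemma 3.5, wedge ⊆ S₁₂ direction, tex ll. 372–375): "conversely every such wedge is a
generator (`u^i_j=\theta(\phi^i_j,\chi'_j)` with `\phi^i_j` of type `\fp_+`, and `u_1\wedge u_2=\vartheta_{T,\chi_{12}}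
(\Phi')` … for `\Phi'=\phi^1_1\otimes\phi^2_2-\phi^2_1\otimes\phi^1_2`)".  = model fact `Open_thetaGen12`. INTERNAL. -/
def N19w_wedgeMem : Prop := T.Open_thetaGen12

/-- **N19g** (PerL v5 Lemma 3.5, S₃₄ ⊆ closed wedge span direction, tex ll. 356–372): "every `K`-finite
generator of `S_{12}` is a linear combination of wedges `u_1\wedge u_2` of such forms" (general Schwartz `Φ` by
density of `pr_κ(𝒫)` and continuity) — in the CLOSURE form of run 12 (DIVERGENCE.md E2).  = `Open_thetaReal34`.
INTERNAL. -/
def N19g_genInWedgeSpan : Prop := T.Open_thetaReal34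

/-- (Ported verbatim from the HodgeCMPerL package; no docstring in the source.) -/
theorem N19w_iff : N19w_wedgeMem T ↔ T.Open_thetaGen12 := Iff.rfl
/-- (Ported verbatim from the HodgeCMPerL package; no docstring in the source.) -/
theorem N19g_iff : N19g_genInWedgeSpan T ↔ T.Open_thetaReal34 := Iff.rfl

end PerL34
end HodgeCM

end
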